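import Literature.IUT.LogVolume.ExplicitEstimatesSzpiroConductorFormCertificateProofs
import HarnessLib

/-!
# [ExpEst] Remark 5.3.3 at `(L, λ) = (ℚ, −9/16)`, II: `rad_ℚ(λ, 1−λ, −1) = 30`, so the recalled input (R0)
# `N(𝔣) ≥ rad_L` FAILS AS PRINTED (`15 < 30`), while (R1) and the displayed lines (R2), (R3) HOLD there

S. Mochizuki, I. Fesenko, Y. Hoshi, A. Minamide, W. Porowski, *Explicit estimates in inter-universal
Teichmüller theory*, Kodai Math. J. **45** (2022) 175–236 — [ExpEst], bib key `MochizukiEtAl2022` (claim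
key, status disputed) — **Remark 5.3.3**, journal p. 222 l. 14 – p. 223 l. 4 (= pdf p48.l14–p49.l4 of the
cell render `…/abc-iut/plan/repair/lit/renders/MFHMP-ExplicitEstimates-Kodai2022-book-anonnd-eeiutp`).
PROOF-ONLY sequel of `ExplicitEstimatesSzpiroConductorFormCertificateProofs` (`legendreCondNorm (−9/16 : ℚ) =
15`, `legendreMinDiscNorm (−9/16 : ℚ) = 50625`) and of `ExplicitEstimatesSzpiroConductorForm` (the typed
sentences: (R1) `Rmk533LocalBound`, (R0) `Rmk533RadLeConductor` — hypothesis predicates quoted verbatim from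
p. 222 l. 34–42 — and the displayed lines (R2) `Rmk533`, (R3) `Rmk533Product`, claim-tagged CANDIDATES).
No definition, no named fact, no instance.

TAKES NO SIDE on [IUTchIII] Cor. 3.12 or on any author. Remark 5.3.3 is a side remark DOWNSTREAM of
Theorem 5.3 (i); what is kernel-checked here is the value of its sentences at ONE point `(ℚ, −9/16)` of its
scope ("In the notation of Theorem 5.3 [`L` mono-complex], let `λ ∈ L^⑂`", p. 222 l. 14; `ℚ` is mono-complex,
Def. 1.2 = tree `isMonoComplex_rat`). Bookkeeping, not judgement; typed ≠ proved ≠ endorsed; no abc / Szpiro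
claim. PROVED:
* §4 **`rad_ℚ(λ, 1−λ, −1) = 30`** for `λ = −9/16` (Thm 5.3's `radL`: the places where `|λ|_v, |1−λ|_v, |−1|_v`
  are not all equal are `2, 3, 5`; tree bridges `radL_eq_radicalNorm`, `radicalNorm_natCast_eq_rad` at the
  abc triple `9 + 16 = 25`, `rad(9·16·25) = 30`);
* §5 **(R0) is FALSE at `(ℚ, −9/16)`** (`rad_ℚ = 30 > 15 = N(𝔣)`): `not_rmk533RadLeConductor_nineSixteenths`;
  hence the universal closure of (R0) over the remark's own scope is refuted
  (`not_forall_rmk533RadLeConductor`). **(R1) HOLDS** there (`log 50625 ≤ h_non(j) + 6(log 15 − log 30) +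
  12 log 2 = log 50625 + 6 log 2`; `h_non(j) = log den(j) = log 50625`, tree `hNon_rat`) — first closed
  instance of the predicate. **(R2), (R3) HOLD at this instance for every `ε > 0`, unconditionally**
  (`50625 ≤ 2¹²·15⁶`): the conclusion printed for `(ℚ, E_{−9/16})` is true although the recalled input (R0)
  used in print to derive it is not — non-vacuity witnesses for the CANDIDATES, no evidence for Theorem 5.3.
Reading note (bookkeeping only): the mechanism is the place `2`, where `λ` is non-integral of EVEN valuation
(`ord₂ λ = −4`): `2 ∈ I_ℚ(λ, 1−λ, −1)` divides `rad_ℚ` while `E_λ` has good reduction at `2` (`f₂ = 0`,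
`…CertificateProofs`); at ODD places `v ∈ I_L` does force `f_v ≥ 1` (AEC VII.5.4 (c)). Nothing here bears
on Thm 5.1, Cor 5.2, Thm 5.3/5.4 of [ExpEst] or on [IUTchIII] Cor. 3.12.
-/

noncomputable section

open NumberField IsDedekindDomain WeierstrassCurve
open Literature.NumberTheory.DiophantineGeometry Literature.NumberTheory.EllipticCurves
open Literature.NumberTheory.DiophantineGeometry.UniformABCConjecture

namespace Literature.IUT.LogVolume

namespace ExpEst

open Cor22 Rat.HeightOneSpectrum

/-! ## 4. `rad_ℚ(λ, 1−λ, −1) = 30` for `λ = −9/16` -/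

/-- The exceptional places `I_ℚ(λ, 1−λ, −1)` of Theorem 5.3 for `λ = −9/16` (where `|−9/16|_v, |25/16|_v,
|−1|_v` are not all equal) are those of the integer triple `(9, 16, 25)` (scale by `−16`, reorder):
`badPrimes(−9/16, 25/16, −1) = badPrimes(9, 16, 25)`. [folklore] -/
private theorem badPrimes_nineSixteenths :
    badPrimes (-9 / 16 : ℚ) (1 - (-9 / 16)) (-1) = badPrimes ((9 : ℕ) : ℚ) ((16 : ℕ) : ℚ) ((25 : ℕ) : ℚ) := by
  ext v
  simp only [badPrimes, Set.mem_setOf_eq]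
  have h16 : v.valuation ℚ ((16 : ℕ) : ℚ) ≠ 0 :=
    (Valuation.ne_zero_iff _).mpr (by norm_num)
  rw [show (1 - (-9 / 16) : ℚ) = ((25 : ℕ) : ℚ) / ((16 : ℕ) : ℚ) by norm_num,
    show (-9 / 16 : ℚ) = -(((9 : ℕ) : ℚ) / ((16 : ℕ) : ℚ)) by norm_num, Valuation.map_neg, map_div₀,
    map_div₀, Valuation.map_neg, Valuation.map_one, div_left_inj' h16, div_eq_one_iff_eq h16]
  refine not_congr ⟨?_, ?_⟩
  · rintro ⟨h1, h2⟩; exact ⟨h1.trans h2, h2.symm⟩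
  · rintro ⟨h1, h2⟩; exact ⟨h1.trans h2, h2.symm⟩

/-- `rad(9·16·25) = rad(2⁴·3²·5²) = 30`. [folklore] -/
private theorem rad_nine_sixteen_twentyFive : rad 9 16 25 = 30 := by
  rw [rad_def, show (9 * 16 * 25 : ℕ) = (3 ^ 2 * 2 ^ 4) * 5 ^ 2 by norm_num,
    UniqueFactorizationMonoid.radical_mul (Nat.coprime_iff_isRelPrime.mp (by norm_num)),
    UniqueFactorizationMonoid.radical_mul (Nat.coprime_iff_isRelPrime.mp (by norm_num)),
    UniqueFactorizationMonoid.radical_pow _ (by norm_num),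
    UniqueFactorizationMonoid.radical_pow _ (by norm_num),
    UniqueFactorizationMonoid.radical_pow _ (by norm_num),
    UniqueFactorizationMonoid.radical_of_prime (Nat.prime_iff.mp (by norm_num)),
    UniqueFactorizationMonoid.radical_of_prime (Nat.prime_iff.mp (by norm_num)),
    UniqueFactorizationMonoid.radical_of_prime (Nat.prime_iff.mp (by norm_num))]
  norm_num [normalize_eq]

/-- **`rad_ℚ(λ, 1−λ, −1) = 30` for `λ = −9/16`** (Thm 5.3's `radL`; = the tree's Granville–Stark
`radicalNorm`, `radL_eq_radicalNorm`; `radicalNorm(9,16,25) = rad(9·16·25)` for the abc triple `9 + 16 = 25`,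
tree `radicalNorm_natCast_eq_rad`): the places `2, 3, 5` all lie in `I_ℚ`.
[cite: MochizukiEtAl2022, Thm 5.3 p. 219 (definition of `rad_L`)] -/
theorem radL_nineSixteenths : radL (-9 / 16 : ℚ) (1 - (-9 / 16)) (-1) = 30 := by
  have habc : IsABCTriple 9 16 25 := ⟨by norm_num, by norm_num, by norm_num, by norm_num⟩
  have h := radicalNorm_natCast_eq_rad habc
  rw [radL_eq_radicalNorm]
  unfold radicalNorm at h ⊢
  rw [badPrimes_nineSixteenths, h, rad_nine_sixteen_twentyFive]

/-! ## 5. The sentences of Remark 5.3.3 at `(L, λ) = (ℚ, −9/16)` -/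

/-- **(R0) FAILS AS PRINTED at `(ℚ, −9/16)`**: the recalled inequality "`N_{L/ℚ}(𝔣_{E_λ}) ≥ rad_L(λ, 1−λ,
−1)`" (p. 222 l. 39–42, typed verbatim as `Rmk533RadLeConductor`) reads `30 ≤ 15` here: the place `2` lies in
`I_ℚ` (`ord₂ λ = −4 ≠ 0`) but `E_{−9/16}` has good reduction at `2` (`f₂ = 0`). One recalled classical
sentence of a side remark, not Theorem 5.3. [cite: MochizukiEtAl2022, Rmk 5.3.3 p. 222 l. 39–42] -/
theorem not_rmk533RadLeConductor_nineSixteenths : ¬ Rmk533RadLeConductor (-9 / 16 : ℚ) := by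
  unfold Rmk533RadLeConductor
  rw [radL_nineSixteenths, legendreCondNorm_nineSixteenths]
  norm_num

/-- The universal closure of (R0) over the remark's own scope ("`L` mono-complex, `λ ∈ L^⑂`") is refuted
by `(ℚ, −9/16)` (`ℚ` is mono-complex: `isMonoComplex_rat`). [cite: MochizukiEtAl2022, Rmk 5.3.3 p. 222 l. 39–42] -/
theorem not_forall_rmk533RadLeConductor :
    ¬ ∀ (L : Type) [Field L] [NumberField L] (lam : L),
        IsMonoComplex L → lam ≠ 0 → lam ≠ 1 → Rmk533RadLeConductor lam :=
  fun h => not_rmk533RadLeConductor_nineSixteenths (h ℚ (-9 / 16) isMonoComplex_rat (by norm_num) (by norm_num))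

/-- `h_non(j(E_{−9/16})) = log 50625`: `j = 111284641/50625` in lowest terms (`481³/(3⁴5⁴)`), and over `ℚ`
`h_non(q) = log den(q)` (tree `hNon_rat`, [ExpEst] Def. 1.1 (i)). [cite: MochizukiEtAl2022, Def 1.1 (i) p. 184] -/
theorem hNon_jInv_nineSixteenths : hNon (jInv (-9 / 16 : ℚ)) = Real.log 50625 := by
  rw [jInv_nineSixteenths.1, hNon_rat]
  norm_num [Rat.den_div_eq_of_coprime]

/-- **(R1) HOLDS at `(ℚ, −9/16)`**: the local comparison "`log N(𝔇) ≤ d·h_non(j) + 6(log N(𝔣) − log rad_L) +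
d(8 − (−4)) log 2`" (p. 222 l. 34–37, typed verbatim as `Rmk533LocalBound`) reads `log 50625 ≤ log 50625 +
6(log 15 − log 30) + 12 log 2 = log 50625 + 6 log 2` (`d = 1`). First closed instance of the predicate.
[cite: MochizukiEtAl2022, Rmk 5.3.3 p. 222 l. 34–37] -/
theorem rmk533LocalBound_nineSixteenths : Rmk533LocalBound (-9 / 16 : ℚ) := by
  unfold Rmk533LocalBound
  rw [legendreMinDiscNorm_nineSixteenths, legendreCondNorm_nineSixteenths, radL_nineSixteenths,
    hNon_jInv_nineSixteenths, Module.finrank_self]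
  have h30 : Real.log ((30 : ℕ) : ℝ) = Real.log 2 + Real.log ((15 : ℕ) : ℝ) := by
    rw [← Real.log_mul (by norm_num) (by norm_num)]; norm_num
  have h2 : 0 < Real.log 2 := Real.log_pos (by norm_num)
  rw [h30]
  norm_num
  linarith

/-- `50625 ≤ 2¹²·15^{6(1+ε)}` for `ε > 0` (`15⁶ = 11390625`): the real arithmetic behind (R2)/(R3) at
`(ℚ, −9/16)`. [folklore] -/
private theorem rmk533_core_bound {ε : ℝ} (hε : 0 < ε) :
    ((50625 : ℕ) : ℝ) ≤ (2 : ℝ) ^ (12 * 1) * ((15 : ℕ) : ℝ) ^ (6 * (1 + ε)) := by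
  have h15 : (11390625 : ℝ) ≤ ((15 : ℕ) : ℝ) ^ (6 * (1 + ε)) := by
    have h : (15 : ℝ) ^ ((6 : ℕ) : ℝ) ≤ (15 : ℝ) ^ (6 * (1 + ε)) :=
      Real.rpow_le_rpow_of_exponent_le (by norm_num) (by push_cast; nlinarith)
    rw [Real.rpow_natCast] at h
    norm_num at h ⊢
    exact h
  calc ((50625 : ℕ) : ℝ) ≤ (2 : ℝ) ^ (12 * 1) * 11390625 := by norm_num
    _ ≤ (2 : ℝ) ^ (12 * 1) * ((15 : ℕ) : ℝ) ^ (6 * (1 + ε)) := by gcongr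

/-- **The displayed lines (R2) (`max` form) and (R3) (product form) HOLD at `(ℚ, −9/16)` for every `ε`**,
unconditionally, by arithmetic: `N(𝔇) = 50625 ≤ 2¹²·15⁶ ≤ 2¹²·Δ_ℚ^{6(1+ε)}·exp(h_1(ε))·15^{6(1+ε)}` (`Δ_ℚ =
1`, `h_1(ε) ≥ 0`). The printed CONCLUSION is true at this instance although the recalled input (R0) is not;
non-vacuity witnesses for the CANDIDATES `Rmk533` / `Rmk533Product`, no evidence for Theorem 5.3.
[cite: MochizukiEtAl2022, Rmk 5.3.3 p. 222 l. 43–47] -/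
theorem rmk533_nineSixteenths (ε : ℝ) : Rmk533 ℚ (-9 / 16) ε := by
  intro _ _ _ hε _
  rw [legendreMinDiscNorm_nineSixteenths, legendreCondNorm_nineSixteenths, absDisc_rat, Module.finrank_self,
    Nat.cast_one, Real.one_rpow, one_mul]
  exact (rmk533_core_bound hε).trans (by gcongr; exact le_max_left _ _)

/-- **(R3) (product form) HOLDS at `(ℚ, −9/16)` for every `ε`**, unconditionally (see `rmk533_nineSixteenths`).
[cite: MochizukiEtAl2022, Rmk 5.3.3 p. 222 l. 46–47] -/
theorem rmk533Product_nineSixteenths (ε : ℝ) : Rmk533Product ℚ (-9 / 16) ε := by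
  intro _ _ _ hε _
  rw [legendreMinDiscNorm_nineSixteenths, legendreCondNorm_nineSixteenths, absDisc_rat, Module.finrank_self,
    Nat.cast_one, Real.one_rpow, mul_one, one_mul]
  have hexp : (1 : ℝ) ≤ Real.exp (hd 1 ε) := Real.one_le_exp (hd_nonneg 1 hε)
  calc ((50625 : ℕ) : ℝ) ≤ (2 : ℝ) ^ (12 * 1) * ((15 : ℕ) : ℝ) ^ (6 * (1 + ε)) := rmk533_core_bound hε
    _ = (2 : ℝ) ^ (12 * 1) * 1 * ((15 : ℕ) : ℝ) ^ (6 * (1 + ε)) := by ring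
    _ ≤ (2 : ℝ) ^ (12 * 1) * Real.exp (hd 1 ε) * ((15 : ℕ) : ℝ) ^ (6 * (1 + ε)) := by gcongr

/-- **Summary at `(L, λ) = (ℚ, −9/16)`** — a point of the remark's scope (`ℚ` mono-complex, `λ ≠ 0, 1`): the
classical input (R1) holds, the recalled input (R0) fails, and both displayed lines (R2), (R3) hold for every
`ε`. Bookkeeping on Remark 5.3.3 only; no side taken on Theorem 5.3 or on [IUTchIII] Cor. 3.12.
[cite: MochizukiEtAl2022, Rmk 5.3.3 p. 222 l. 14 – p. 223 l. 4] -/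
theorem rmk533_sentences_nineSixteenths :
    IsMonoComplex ℚ ∧ (-9 / 16 : ℚ) ≠ 0 ∧ (-9 / 16 : ℚ) ≠ 1 ∧
      Rmk533LocalBound (-9 / 16 : ℚ) ∧ ¬ Rmk533RadLeConductor (-9 / 16 : ℚ) ∧
      (∀ ε : ℝ, Rmk533 ℚ (-9 / 16) ε) ∧ ∀ ε : ℝ, Rmk533Product ℚ (-9 / 16) ε :=
  ⟨isMonoComplex_rat, by norm_num, by norm_num, rmk533LocalBound_nineSixteenths,
    not_rmk533RadLeConductor_nineSixteenths, rmk533_nineSixteenths, rmk533Product_nineSixteenths⟩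

end ExpEst

end Literature.IUT.LogVolume
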